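import Literature.Probability.Process.RenewalTheorem
import Mathlib.Analysis.SpecialFunctions.Pow.Real
import Mathlib.Analysis.SpecialFunctions.Trigonometric.Basic
import HarnessLib

/-!
# The strong renewal theorem with infinite mean, index `α ∈ (1/2, 1)` (Garsia–Lamperti; Caravenna–Doney Theorem 1.4)

Topic `Literature/Probability/Process`, continuing `RenewalSequenceRecurrence.lean` /
`RenewalTheorem.lean` (same conventions: nonnegative `u, f : ℕ → ℝ`, `u₀ = 1`, `f₀ = 0`, `uₙ ≤ 1`,
renewal equation `uₙ = Σ_{k ≤ n} f_k u_{n-k}` for `n ≥ 1`, tail sums `r_n = 1 - Σ_{k ≤ n} f_k`).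

`RenewalTheorem.lean` proves the Erdős–Feller–Pollard theorem: `uₙ → 1/Σ k f_k`, read as `0` when the
mean is infinite. The present file records, as a NAMED FACT (not proved here), the sharp asymptotics
of `uₙ` in the infinite-mean case with a regularly varying tail of index `-α`, `α ∈ (1/2, 1)` — the
*strong renewal theorem* (SRT) of Garsia–Lamperti (1963), in the form printed by Caravenna–Doney (2019).

Source: F. Caravenna, R. Doney, *Local large deviations and the strong renewal theorem*,
Electron. J. Probab. **24** (2019), paper no. 72 (arXiv:1612.07635), §1.2–§1.3 [CaravennaDoney2019].
Setting (§1.2, arXiv text p0004:L1–44): `F` is a law on `[0,∞)`, arithmetic with span `h` if supported by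
`hℤ` with `h` maximal, `I = (-h, 0]`; the renewal measure is `U(dx) := Σ_{n ≥ 0} F^{*n}(dx) = Σ_{n ≥ 0}
P(S_n ∈ dx)` (eq. (1.5)); "(SRT) `U(x+I) = U((x-h,x]) ∼ 𝖢 h A(x)/x` as `x → ∞`", where "in the special
case when `p = 1` and `q = 0` … one has `𝖢 = (1/π) sin(πα)`" (p0004:L34–37, L43). Hypothesis (1.7)
(p0004:L117–124): "`F̄(x) ∼ 1/A(x)` as `x → ∞` for some `A ∈ RV(α)`".

> **Theorem 1.4 (SRT for Renewal Processes).** Let `F` be a probability on `[0,∞)` satisfying (1.7)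
> with `α ∈ (0, 1)`. Define `I = (-h,0]` with `h > 0` as in (1.4).
> * If `α > 1/2`, the SRT holds with no extra assumption on `F`.
> * If `α ≤ 1/2`, the SRT holds if and only if `I₁⁺(δ;x)` is a.n. (see Definition 1.3).

(arXiv text p0004:L137–146; the first bullet is the theorem of Garsia–Lamperti [GL], Williamson,
Erickson cited there at p0004:L56–57, and is re-proved in §4.1 of the paper from its Theorem 1.1.)

## What is typed (the first bullet, discrete pure-power case)

We type the FIRST bullet for an arithmetic law of span `1` carried by `ℕ = {1,2,…}` — weights
`f_k = F({k})`, `f₀ = 0`, `Σ f_k = 1`, aperiodicity in the form `f₁ > 0` (so the span is exactly `h = 1`)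
— and for the pure-power scale function `A(x) = x^α / c`, `c > 0` (which is in `RV(α)`, continuous and
strictly increasing). For such `F` the renewal mass of the singleton `{n} = n + I` is
`U({n}) = Σ_m P(S_m = n) = uₙ`, the renewal sequence of `f` (`u₀ = 1`, `uₙ = Σ_{k ≤ n} f_k u_{n-k}`), and
`F̄(n) = Σ_{k > n} f_k = 1 - Σ_{k ≤ n} f_k = r_n`; hypothesis (1.7) reads `r_n · n^α → c`, and (SRT) at
`x = n` reads `uₙ ∼ (sin(πα)/π) · n^{α-1}/c`, i.e. `uₙ · n^{1-α} → sin(πα)/(π c)`.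
-- TODO(general form): `A ∈ RV(α)` (`A(x) = x^α ℓ(x)` with `ℓ` slowly varying,
-- `Literature.Analysis.Asymptotics.IsSlowlyVarying`), aperiodicity as `gcd {n : f_n > 0} = 1`, a possible
-- atom at `0`, non-arithmetic laws, and the second bullet (`α ≤ 1/2`: SRT iff `I₁⁺(δ;x)` is a.n.).

Consistency check of the constant (this file's author, not in the source): for `f_k = k^{-α} - (k+1)^{-α}`
(`α = 3/4`, `c = 1`) the computed `uₙ n^{1/4}` equals `0.2535 / 0.2447 / 0.2427` at `n = 10³ / 4·10³ /
6·10³`, approaching `sin(3π/4)/π = 0.22508` with the expected `O(n^{α-1})` correction (`≈ 0.69 n^{-1/4}`).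
-/

noncomputable section

open Finset Filter Topology

namespace Literature.Probability.Process.Renewal

/-- **Caravenna–Doney 2019, Theorem 1.4, first bullet (the strong renewal theorem for `α ∈ (1/2,1)`;
Garsia–Lamperti 1963), discrete pure-power case** — NAMED FACT, not proved here: for a renewal sequence
`u` of an aperiodic (`f₁ > 0`) probability `f` on `{1,2,…}` whose tail sums satisfy
`(1 - Σ_{k ≤ n} f_k) · n^α → c > 0` with `1/2 < α < 1`, one has `uₙ · n^{1-α} → sin(πα)/(π c)`
("If `α > 1/2`, the SRT holds with no extra assumption on `F`", SRT = `U((x-h,x]) ∼ 𝖢 h A(x)/x`,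
`𝖢 = (1/π) sin(πα)`, here `h = 1`, `A(x) = x^α/c`, `U({n}) = uₙ`).
[cite: CaravennaDoney2019, Theorem 1.4 (first bullet), §1.3; (SRT) and 𝖢 = sin(πα)/π in §1.2] -/
def CaravennaDoney2019_thm1_4_i : Prop :=
  ∀ (u f : ℕ → ℝ) (α c : ℝ), 1 / 2 < α → α < 1 → 0 < c →
    u 0 = 1 → (∀ n, 0 ≤ u n) → (∀ n, u n ≤ 1) → (∀ k, 0 ≤ f k) → f 0 = 0 →
    (∀ n, 1 ≤ n → u n = ∑ k ∈ range (n + 1), f k * u (n - k)) → HasSum f 1 → 0 < f 1 →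
    Tendsto (fun n : ℕ => (1 - ∑ k ∈ range (n + 1), f k) * (n : ℝ) ^ α) atTop (𝓝 c) →
    Tendsto (fun n : ℕ => u n * (n : ℝ) ^ (1 - α)) atTop (𝓝 (Real.sin (Real.pi * α) / (Real.pi * c)))

end Literature.Probability.Process.Renewal

end
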